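import Summits.CriticalPhenomena.PercolationContinuityZ3.Theorems.PercNearOneGluingNoHeavyLowerTailSahiGridPatternUpperStepForm
import Summits.CriticalPhenomena.PercolationContinuityZ3.Theorems.PercNearOneGluingNoHeavyLowerTailSahiGridPatternTwoSetsTop
import Summits.CriticalPhenomena.PercolationContinuityZ3.Theorems.PercNearOneGluingNoHeavyLowerTailSahiGridPatternTopOnlyTop

/-!
# `NoHeavyLowerTail` (crux stmt-CriticalPhenomena-4575), Sahi programme: **THE κ-FORM OF THE UPPER-STEP SLACK, EVERY DIMENSION — COMB-M⁺ holds at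
# every upper-step triple whose TOP triple has nonnegative comb third central moment**

Support file (seat `prim-ineq-gen-4`, generation 13; `--supports stmt-CriticalPhenomena-4575`).  Pure proofs, no definitions, no `sorry`, standard axioms.
Vocabulary and machinery of `…SahiGridPattern{UpperStepForm,TwoLayerTop,TwoSetsTop,TopOnlyTop,Kleitman,Harris}`.

THE MATHEMATICS.  For an UPPER-STEP triple `Au, Bu, Cu ⊆ [3]^{n+1}` (level-`1` slice = level-`2` slice; bottom slices `A⁰ ⊆ A²`, `B⁰ ⊆ B²`, `C⁰ ⊆ C²`)
the symmetric form of generation 12 (`sStarD_upperStep_sub_two_mul_top`) regroups into the **κ-FORM** (`sStarD_upperStep_kappaForm`):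
  `sStarD Au Bu Cu − 2·sStarD A² B² C² = 2·( K(τ) + Θ_A + Θ_B + Θ_C + H_A + H_B + H_C + R₂ )`,
  `K(τ) = 2^n D(A²B²C²) − N(A²;B²,C²) − N(B²;A²,C²) − N(C²;A²,B²) + 2L(τ)`  — the comb THIRD CENTRAL MOMENT of the top triple
     (`2·sStarD τ = K(τ) + Σ_cyc [2^n D − N(X²;Y²,Z²)]`, three coefficientwise-Harris gaps),
  `Θ_A = [N(A²;B²,C²) − N(A⁰;B²,C²)] − [L(A²;B²,C²) − L(A⁰;B²,C²)] ≥ 0`  (fibre Kleitman with the increment `A² ∖ A⁰` as free argument; `Θ_B, Θ_C` alike),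
  `H_A = 2^n D(A²,B⁰,C⁰) − N(A²;B⁰,C⁰) ≥ 0`  (coefficientwise Harris of the bottom meet `B⁰ ∩ C⁰` against the top `A²`; `H_B, H_C` alike),
  `R₂ = 2^n Σ_p 1_{A²B²C²}·[at least two of A⁰,B⁰,C⁰ fail at p] = 2^n[D(A²B²C²) − D(A⁰B⁰C²) − D(A⁰B²C⁰) − D(A²B⁰C⁰) + 2D(A⁰B⁰C⁰)] ≥ 0`.
This is the coefficientwise (every profile / Latin) form of the measure-level identity `T⁺ = κ₃(G) + Σδ_k Cov(G_i,G_j) + ΣCov(H_iH_j,G_k) + r₂`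
of `…SahiTwoLevelKappa` (seat `prim-bnk-2`, generation 9).  CONSEQUENCE (`two_mul_sStarD_top_le_of_upperStep_of_kappa_nonneg`): **COMB-M⁺ (`2·sStarD A²B²C² ≤
sStarD Au Bu Cu`, cube `c₂ ≥ c₃`) holds for every upper-step triple of up-sets whose top triple has `K(τ) ≥ 0`** — the conjecture is open only at tops
with NEGATIVE comb third central moment.  The empty-bottom face (`…SahiGridPatternEmptyBottom`) is the case `C⁰ = ∅` of the κ-form.
Memo: `run/shared/lean/prim/prim-ineq-gen-4/FINDING-EMPTY-BOTTOM-FACE-g13.md` §2b.  HONEST LABEL: COMB-M⁺ in general remains OPEN; nothing here asserts it. [this work]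
-/

namespace Summit.CriticalPhenomena.PercolationContinuityZ3.Theorems.SahiGridPattern

open Finset SahiGrid3
open scoped BigOperators

variable {n : ℕ}

/-- **THE κ-FORM OF THE UPPER-STEP SLACK** (every `n`; an identity, no up-set hypothesis): for an upper-step triple `Au, Bu, Cu ⊆ [3]^{n+1}`,
`sStarD Au Bu Cu − 2·sStarD A²B²C² = 2·(K(τ) + Θ_A + Θ_B + Θ_C + H_A + H_B + H_C + R₂)` with the eight terms written out in slice counts. [this work] -/
theorem sStarD_upperStep_kappaForm (Au Bu Cu : Finset (Pd (n + 1)))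
    (hAu : ∀ q : Pd n, ind Au (Fin.snoc q 1 : Pd (n + 1)) = ind Au (Fin.snoc q 2 : Pd (n + 1)))
    (hBu : ∀ q : Pd n, ind Bu (Fin.snoc q 1 : Pd (n + 1)) = ind Bu (Fin.snoc q 2 : Pd (n + 1)))
    (hCu : ∀ q : Pd n, ind Cu (Fin.snoc q 1 : Pd (n + 1)) = ind Cu (Fin.snoc q 2 : Pd (n + 1))) :
    sStarD Au Bu Cu - 2 * sStarD (univ.filter fun q : Pd n => (Fin.snoc q 2 : Pd (n + 1)) ∈ Au) (univ.filter fun q : Pd n => (Fin.snoc q 2 : Pd (n + 1)) ∈ Bu) (univ.filter fun q : Pd n => (Fin.snoc q 2 : Pd (n + 1)) ∈ Cu) =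
      2 * ((2 ^ n * (∑ p, ind (univ.filter fun q : Pd n => (Fin.snoc q 2 : Pd (n + 1)) ∈ Au) p * ind (univ.filter fun q : Pd n => (Fin.snoc q 2 : Pd (n + 1)) ∈ Bu) p * ind (univ.filter fun q : Pd n => (Fin.snoc q 2 : Pd (n + 1)) ∈ Cu) p) - (∑ p, ∑ q, ind (univ.filter fun q : Pd n => (Fin.snoc q 2 : Pd (n + 1)) ∈ Au) p * ind (univ.filter fun q : Pd n => (Fin.snoc q 2 : Pd (n + 1)) ∈ Bu) q * ind (univ.filter fun q : Pd n => (Fin.snoc q 2 : Pd (n + 1)) ∈ Cu) q * (if TotDist p q = true then (1:ℤ) else 0)) - (∑ p, ∑ q, ind (univ.filter fun q : Pd n => (Fin.snoc q 2 : Pd (n + 1)) ∈ Bu) p * ind (univ.filter fun q : Pd n => (Fin.snoc q 2 : Pd (n + 1)) ∈ Au) q * ind (univ.filter fun q : Pd n => (Fin.snoc q 2 : Pd (n + 1)) ∈ Cu) q * (if TotDist p q = true then (1:ℤ) else 0)) - (∑ p, ∑ q, ind (univ.filter fun q : Pd n => (Fin.snoc q 2 : Pd (n + 1)) ∈ Cu)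 p * ind (univ.filter fun q : Pd n => (Fin.snoc q 2 : Pd (n + 1)) ∈ Au) q * ind (univ.filter fun q : Pd n => (Fin.snoc q 2 : Pd (n + 1)) ∈ Bu) q * (if TotDist p q = true then (1:ℤ) else 0)) + 2 * (∑ q, ∑ r, ind (univ.filter fun q : Pd n => (Fin.snoc q 2 : Pd (n + 1)) ∈ Bu) q * ind (univ.filter fun q : Pd n => (Fin.snoc q 2 : Pd (n + 1)) ∈ Cu) r * ind (univ.filter fun q : Pd n => (Fin.snoc q 2 : Pd (n + 1)) ∈ Au) (thirdPt q r) * (if TotDist q r = true then (1:ℤ) else 0)))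
        + ((∑ p, ∑ q, ind (univ.filter fun q : Pd n => (Fin.snoc q 2 : Pd (n + 1)) ∈ Au) p * ind (univ.filter fun q : Pd n => (Fin.snoc q 2 : Pd (n + 1)) ∈ Bu) q * ind (univ.filter fun q : Pd n => (Fin.snoc q 2 : Pd (n + 1)) ∈ Cu) q * (if TotDist p q = true then (1:ℤ) else 0)) - (∑ p, ∑ q, ind (univ.filter fun q : Pd n => (Fin.snoc q 0 : Pd (n + 1)) ∈ Au) p * ind (univ.filter fun q : Pd n => (Fin.snoc q 2 : Pd (n + 1)) ∈ Bu) q * ind (univ.filter fun q : Pd n => (Fin.snoc q 2 : Pd (n + 1)) ∈ Cu) q * (if TotDist p q = true then (1:ℤ) else 0)) - (∑ q, ∑ r, ind (univ.filter fun q : Pd n => (Fin.snoc q 2 : Pd (n + 1)) ∈ Bu) q * ind (univ.filter fun q : Pd n => (Fin.snoc q 2 : Pd (n + 1)) ∈ Cu) r * ind (univ.filter fun q : Pd n => (Fin.snoc q 2 : Pd (n + 1)) ∈ Au) (thirdPt q r) * (if TotDist q r = true then (1:ℤ) else 0)) + (∑ q, ∑ r, ind (univ.filter fun q : Pd n =>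 (Fin.snoc q 2 : Pd (n + 1)) ∈ Bu) q * ind (univ.filter fun q : Pd n => (Fin.snoc q 2 : Pd (n + 1)) ∈ Cu) r * ind (univ.filter fun q : Pd n => (Fin.snoc q 0 : Pd (n + 1)) ∈ Au) (thirdPt q r) * (if TotDist q r = true then (1:ℤ) else 0)))
        + ((∑ p, ∑ q, ind (univ.filter fun q : Pd n => (Fin.snoc q 2 : Pd (n + 1)) ∈ Bu) p * ind (univ.filter fun q : Pd n => (Fin.snoc q 2 : Pd (n + 1)) ∈ Au) q * ind (univ.filter fun q : Pd n => (Fin.snoc q 2 : Pd (n + 1)) ∈ Cu) q * (if TotDist p q = true then (1:ℤ) else 0)) - (∑ p, ∑ q, ind (univ.filter fun q : Pd n => (Fin.snoc q 0 : Pd (n + 1)) ∈ Bu) p * ind (univ.filter fun q : Pd n => (Fin.snoc q 2 : Pd (n + 1)) ∈ Au) q * ind (univ.filter fun q : Pd n => (Fin.snoc q 2 : Pd (n + 1)) ∈ Cu) q * (if TotDist p q = true then (1:ℤ) else 0)) - (∑ q, ∑ r, ind (univ.filter fun q : Pd n => (Fin.snoc q 2 : Pd (n + 1)) ∈ Bu)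 q * ind (univ.filter fun q : Pd n => (Fin.snoc q 2 : Pd (n + 1)) ∈ Cu) r * ind (univ.filter fun q : Pd n => (Fin.snoc q 2 : Pd (n + 1)) ∈ Au) (thirdPt q r) * (if TotDist q r = true then (1:ℤ) else 0)) + (∑ q, ∑ r, ind (univ.filter fun q : Pd n => (Fin.snoc q 0 : Pd (n + 1)) ∈ Bu) q * ind (univ.filter fun q : Pd n => (Fin.snoc q 2 : Pd (n + 1)) ∈ Cu) r * ind (univ.filter fun q : Pd n => (Fin.snoc q 2 : Pd (n + 1)) ∈ Au) (thirdPt q r) * (if TotDist q r = true then (1:ℤ) else 0)))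
        + ((∑ p, ∑ q, ind (univ.filter fun q : Pd n => (Fin.snoc q 2 : Pd (n + 1)) ∈ Cu) p * ind (univ.filter fun q : Pd n => (Fin.snoc q 2 : Pd (n + 1)) ∈ Au) q * ind (univ.filter fun q : Pd n => (Fin.snoc q 2 : Pd (n + 1)) ∈ Bu) q * (if TotDist p q = true then (1:ℤ) else 0)) - (∑ p, ∑ q, ind (univ.filter fun q : Pd n => (Fin.snoc q 0 : Pd (n + 1)) ∈ Cu) p * ind (univ.filter fun q : Pd n => (Fin.snoc q 2 : Pd (n + 1)) ∈ Au) q * ind (univ.filter fun q : Pd n => (Fin.snoc q 2 : Pd (n + 1)) ∈ Bu) q * (if TotDist p q = true then (1:ℤ) else 0)) - (∑ q, ∑ r, ind (univ.filter fun q : Pd n => (Fin.snoc q 2 : Pd (n + 1)) ∈ Bu) q * ind (univ.filter fun q : Pd n => (Fin.snoc q 2 : Pd (n + 1)) ∈ Cu) r * ind (univ.filter fun q : Pd n => (Fin.snoc q 2 : Pd (n + 1)) ∈ Au) (thirdPt q r) * (if TotDist q r = true then (1:ℤ) else 0)) + (∑ q, ∑ r, ind (univ.filter fun q : Pd n =>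 (Fin.snoc q 2 : Pd (n + 1)) ∈ Bu) q * ind (univ.filter fun q : Pd n => (Fin.snoc q 0 : Pd (n + 1)) ∈ Cu) r * ind (univ.filter fun q : Pd n => (Fin.snoc q 2 : Pd (n + 1)) ∈ Au) (thirdPt q r) * (if TotDist q r = true then (1:ℤ) else 0)))
        + (2 ^ n * (∑ p, ind (univ.filter fun q : Pd n => (Fin.snoc q 2 : Pd (n + 1)) ∈ Au) p * ind (univ.filter fun q : Pd n => (Fin.snoc q 0 : Pd (n + 1)) ∈ Bu) p * ind (univ.filter fun q : Pd n => (Fin.snoc q 0 : Pd (n + 1)) ∈ Cu) p) - (∑ p, ∑ q, ind (univ.filter fun q : Pd n => (Fin.snoc q 2 : Pd (n + 1)) ∈ Au) p * ind (univ.filter fun q : Pd n => (Fin.snoc q 0 : Pd (n + 1)) ∈ Bu) q * ind (univ.filter fun q : Pd n => (Fin.snoc q 0 : Pd (n + 1)) ∈ Cu) q * (if TotDist p q = true then (1:ℤ) else 0)))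
        + (2 ^ n * (∑ p, ind (univ.filter fun q : Pd n => (Fin.snoc q 0 : Pd (n + 1)) ∈ Au) p * ind (univ.filter fun q : Pd n => (Fin.snoc q 2 : Pd (n + 1)) ∈ Bu) p * ind (univ.filter fun q : Pd n => (Fin.snoc q 0 : Pd (n + 1)) ∈ Cu) p) - (∑ p, ∑ q, ind (univ.filter fun q : Pd n => (Fin.snoc q 2 : Pd (n + 1)) ∈ Bu) p * ind (univ.filter fun q : Pd n => (Fin.snoc q 0 : Pd (n + 1)) ∈ Au) q * ind (univ.filter fun q : Pd n => (Fin.snoc q 0 : Pd (n + 1)) ∈ Cu) q * (if TotDist p q = true then (1:ℤ) else 0)))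
        + (2 ^ n * (∑ p, ind (univ.filter fun q : Pd n => (Fin.snoc q 0 : Pd (n + 1)) ∈ Au) p * ind (univ.filter fun q : Pd n => (Fin.snoc q 0 : Pd (n + 1)) ∈ Bu) p * ind (univ.filter fun q : Pd n => (Fin.snoc q 2 : Pd (n + 1)) ∈ Cu) p) - (∑ p, ∑ q, ind (univ.filter fun q : Pd n => (Fin.snoc q 2 : Pd (n + 1)) ∈ Cu) p * ind (univ.filter fun q : Pd n => (Fin.snoc q 0 : Pd (n + 1)) ∈ Au) q * ind (univ.filter fun q : Pd n => (Fin.snoc q 0 : Pd (n + 1)) ∈ Bu) q * (if TotDist p q = true then (1:ℤ) else 0)))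
        + (2 ^ n * ((∑ p, ind (univ.filter fun q : Pd n => (Fin.snoc q 2 : Pd (n + 1)) ∈ Au) p * ind (univ.filter fun q : Pd n => (Fin.snoc q 2 : Pd (n + 1)) ∈ Bu) p * ind (univ.filter fun q : Pd n => (Fin.snoc q 2 : Pd (n + 1)) ∈ Cu) p) - (∑ p, ind (univ.filter fun q : Pd n => (Fin.snoc q 0 : Pd (n + 1)) ∈ Au) p * ind (univ.filter fun q : Pd n => (Fin.snoc q 0 : Pd (n + 1)) ∈ Bu) p * ind (univ.filter fun q : Pd n => (Fin.snoc q 2 : Pd (n + 1)) ∈ Cu) p) - (∑ p, ind (univ.filter fun q : Pd n => (Fin.snoc q 0 : Pd (n + 1)) ∈ Au) p * ind (univ.filter fun q : Pd n => (Fin.snoc q 2 : Pd (n + 1)) ∈ Bu) p * ind (univ.filter fun q : Pd n => (Fin.snoc q 0 : Pd (n + 1)) ∈ Cu) p) - (∑ p, ind (univ.filter fun q : Pd n => (Fin.snoc q 2 : Pd (n + 1)) ∈ Au) p * ind (univ.filter fun q : Pd n => (Fin.snoc q 0 : Pd (n + 1)) ∈ Bu) p * ind (univ.filter fun q : Pd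 n => (Fin.snoc q 0 : Pd (n + 1)) ∈ Cu) p) + 2 * (∑ p, ind (univ.filter fun q : Pd n => (Fin.snoc q 0 : Pd (n + 1)) ∈ Au) p * ind (univ.filter fun q : Pd n => (Fin.snoc q 0 : Pd (n + 1)) ∈ Bu) p * ind (univ.filter fun q : Pd n => (Fin.snoc q 0 : Pd (n + 1)) ∈ Cu) p)))) := by
  rw [sStarD_upperStep_sub_two_mul_top Au Bu Cu hAu hBu hCu, sStarD_counting (univ.filter fun q : Pd n => (Fin.snoc q 2 : Pd (n + 1)) ∈ Au) (univ.filter fun q : Pd n => (Fin.snoc q 2 : Pd (n + 1)) ∈ Bu) (univ.filter fun q : Pd n => (Fin.snoc q 2 : Pd (n + 1)) ∈ Cu),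
    sStarD_counting (univ.filter fun q : Pd n => (Fin.snoc q 0 : Pd (n + 1)) ∈ Au) (univ.filter fun q : Pd n => (Fin.snoc q 0 : Pd (n + 1)) ∈ Bu) (univ.filter fun q : Pd n => (Fin.snoc q 0 : Pd (n + 1)) ∈ Cu),
    sum_incr_meet_expand (ind (univ.filter fun q : Pd n => (Fin.snoc q 0 : Pd (n + 1)) ∈ Au)) (ind (univ.filter fun q : Pd n => (Fin.snoc q 2 : Pd (n + 1)) ∈ Au)) (ind (univ.filter fun q : Pd n => (Fin.snoc q 0 : Pd (n + 1)) ∈ Bu)) (ind (univ.filter fun q : Pd n => (Fin.snoc q 2 : Pd (n + 1)) ∈ Bu)) (ind (univ.filter fun q : Pd n => (Fin.snoc q 0 : Pd (n + 1)) ∈ Cu)) (ind (univ.filter fun q : Pd n => (Fin.snoc q 2 : Pd (n + 1)) ∈ Cu)) (fun p q => (if TotDist p q = true then (1:ℤ) else 0)),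
    sum_incr_meet_expand (ind (univ.filter fun q : Pd n => (Fin.snoc q 0 : Pd (n + 1)) ∈ Bu)) (ind (univ.filter fun q : Pd n => (Fin.snoc q 2 : Pd (n + 1)) ∈ Bu)) (ind (univ.filter fun q : Pd n => (Fin.snoc q 0 : Pd (n + 1)) ∈ Au)) (ind (univ.filter fun q : Pd n => (Fin.snoc q 2 : Pd (n + 1)) ∈ Au)) (ind (univ.filter fun q : Pd n => (Fin.snoc q 0 : Pd (n + 1)) ∈ Cu)) (ind (univ.filter fun q : Pd n => (Fin.snoc q 2 : Pd (n + 1)) ∈ Cu)) (fun p q => (if TotDist p q = true then (1:ℤ) else 0)),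
    sum_incr_meet_expand (ind (univ.filter fun q : Pd n => (Fin.snoc q 0 : Pd (n + 1)) ∈ Cu)) (ind (univ.filter fun q : Pd n => (Fin.snoc q 2 : Pd (n + 1)) ∈ Cu)) (ind (univ.filter fun q : Pd n => (Fin.snoc q 0 : Pd (n + 1)) ∈ Au)) (ind (univ.filter fun q : Pd n => (Fin.snoc q 2 : Pd (n + 1)) ∈ Au)) (ind (univ.filter fun q : Pd n => (Fin.snoc q 0 : Pd (n + 1)) ∈ Bu)) (ind (univ.filter fun q : Pd n => (Fin.snoc q 2 : Pd (n + 1)) ∈ Bu)) (fun p q => (if TotDist p q = true then (1:ℤ) else 0)),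
    sum_incr_latin_expand (ind (univ.filter fun q : Pd n => (Fin.snoc q 0 : Pd (n + 1)) ∈ Au)) (ind (univ.filter fun q : Pd n => (Fin.snoc q 2 : Pd (n + 1)) ∈ Au)) (ind (univ.filter fun q : Pd n => (Fin.snoc q 0 : Pd (n + 1)) ∈ Bu)) (ind (univ.filter fun q : Pd n => (Fin.snoc q 2 : Pd (n + 1)) ∈ Bu)) (ind (univ.filter fun q : Pd n => (Fin.snoc q 0 : Pd (n + 1)) ∈ Cu)) (ind (univ.filter fun q : Pd n => (Fin.snoc q 2 : Pd (n + 1)) ∈ Cu)) thirdPt (fun q r => (if TotDist q r = true then (1:ℤ) else 0))]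
  ring

/-- Pointwise nonnegativity of the `R₂` integrand: for `0/1` values `a ≤ a'`, `b ≤ b'`, `c ≤ c'`,
`a'b'c' − abc' − ab'c − a'bc + 2abc ≥ 0` (it is the indicator of "at least two of a,b,c fail" on `a'b'c' = 1`). [this work] -/
theorem r2_pointwise_nonneg (a a' b b' c c' : ℤ) (ha : a = 0 ∨ a = 1) (ha' : a' = 0 ∨ a' = 1) (hb : b = 0 ∨ b = 1) (hb' : b' = 0 ∨ b' = 1)
    (hc : c = 0 ∨ c = 1) (hc' : c' = 0 ∨ c' = 1) (haa : a ≤ a') (hbb : b ≤ b') (hcc : c ≤ c') :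
    0 ≤ a' * b' * c' - a * b * c' - a * b' * c - a' * b * c + 2 * (a * b * c) := by
  rcases ha with rfl | rfl <;> rcases ha' with rfl | rfl <;> rcases hb with rfl | rfl <;> rcases hb' with rfl | rfl <;>
    rcases hc with rfl | rfl <;> rcases hc' with rfl | rfl <;> omega

/-- **COMB-M⁺ AT TOPS WITH NONNEGATIVE COMB THIRD CENTRAL MOMENT** (every `n`): for an upper-step triple of up-sets `Au, Bu, Cu ⊆ [3]^{n+1}` whose
top slices satisfy `K(τ) = 2^n D(A²B²C²) − N(A²;B²,C²) − N(B²;A²,C²) − N(C²;A²,B²) + 2L(τ) ≥ 0`, top-slice dominance holds: `2·sStarD A²B²C² ≤ sStarD Au Bu Cu`.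
Proof: the κ-form; `Θ ≥ 0` by fibre Kleitman with the increments as free argument, `H ≥ 0` by coefficientwise Harris, `R₂ ≥ 0` pointwise. [this work] -/
theorem two_mul_sStarD_top_le_of_upperStep_of_kappa_nonneg (Au Bu Cu : Finset (Pd (n + 1)))
    (hA : IsUpperSet (Au : Set (Pd (n + 1)))) (hB : IsUpperSet (Bu : Set (Pd (n + 1)))) (hC : IsUpperSet (Cu : Set (Pd (n + 1))))
    (hAu : ∀ q : Pd n, ind Au (Fin.snoc q 1 : Pd (n + 1)) = ind Au (Fin.snoc q 2 : Pd (n + 1)))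
    (hBu : ∀ q : Pd n, ind Bu (Fin.snoc q 1 : Pd (n + 1)) = ind Bu (Fin.snoc q 2 : Pd (n + 1)))
    (hCu : ∀ q : Pd n, ind Cu (Fin.snoc q 1 : Pd (n + 1)) = ind Cu (Fin.snoc q 2 : Pd (n + 1)))
    (hK : 0 ≤ (2 ^ n * (∑ p, ind (univ.filter fun q : Pd n => (Fin.snoc q 2 : Pd (n + 1)) ∈ Au) p * ind (univ.filter fun q : Pd n => (Fin.snoc q 2 : Pd (n + 1)) ∈ Bu) p * ind (univ.filter fun q : Pd n => (Fin.snoc q 2 : Pd (n + 1)) ∈ Cu) p) - (∑ p, ∑ q, ind (univ.filter fun q : Pd n => (Fin.snoc q 2 : Pd (n + 1)) ∈ Au) p * ind (univ.filter fun q : Pd n => (Fin.snoc q 2 : Pd (n + 1)) ∈ Bu) q * ind (univ.filter fun q : Pd n => (Fin.snoc q 2 : Pd (n + 1)) ∈ Cu) q * (if TotDist p q = true then (1:ℤ) else 0)) - (∑ p, ∑ q, ind (univ.filter fun q : Pd n => (Fin.snoc q 2 : Pd (n + 1)) ∈ Bu) p * ind (univ.filter fun q : Pd n => (Fin.snoc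 q 2 : Pd (n + 1)) ∈ Au) q * ind (univ.filter fun q : Pd n => (Fin.snoc q 2 : Pd (n + 1)) ∈ Cu) q * (if TotDist p q = true then (1:ℤ) else 0)) - (∑ p, ∑ q, ind (univ.filter fun q : Pd n => (Fin.snoc q 2 : Pd (n + 1)) ∈ Cu) p * ind (univ.filter fun q : Pd n => (Fin.snoc q 2 : Pd (n + 1)) ∈ Au) q * ind (univ.filter fun q : Pd n => (Fin.snoc q 2 : Pd (n + 1)) ∈ Bu) q * (if TotDist p q = true then (1:ℤ) else 0)) + 2 * (∑ q, ∑ r, ind (univ.filter fun q : Pd n => (Fin.snoc q 2 : Pd (n + 1)) ∈ Bu) q * ind (univ.filter fun q : Pd n => (Fin.snoc q 2 : Pd (n + 1)) ∈ Cu) r * ind (univ.filter fun q : Pd n => (Fin.snoc q 2 : Pd (n + 1)) ∈ Au) (thirdPt q r) * (if TotDist q r = true then (1:ℤ) else 0)))) :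
    2 * sStarD (univ.filter fun q : Pd n => (Fin.snoc q 2 : Pd (n + 1)) ∈ Au) (univ.filter fun q : Pd n => (Fin.snoc q 2 : Pd (n + 1)) ∈ Bu) (univ.filter fun q : Pd n => (Fin.snoc q 2 : Pd (n + 1)) ∈ Cu) ≤ sStarD Au Bu Cu := by
  have eK := sStarD_upperStep_kappaForm Au Bu Cu hAu hBu hCu
  -- up-set and nesting facts for the slices
  have hA2up : IsUpperSet (((univ.filter fun q : Pd n => (Fin.snoc q 2 : Pd (n + 1)) ∈ Au) : Finset (Pd n)) : Set (Pd n)) := isUpperSet_filter_snoc hA 2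
  have hB2up : IsUpperSet (((univ.filter fun q : Pd n => (Fin.snoc q 2 : Pd (n + 1)) ∈ Bu) : Finset (Pd n)) : Set (Pd n)) := isUpperSet_filter_snoc hB 2
  have hC2up : IsUpperSet (((univ.filter fun q : Pd n => (Fin.snoc q 2 : Pd (n + 1)) ∈ Cu) : Finset (Pd n)) : Set (Pd n)) := isUpperSet_filter_snoc hC 2
  have hA0up : IsUpperSet (((univ.filter fun q : Pd n => (Fin.snoc q 0 : Pd (n + 1)) ∈ Au) : Finset (Pd n)) : Set (Pd n)) := isUpperSet_filter_snoc hA 0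
  have hB0up : IsUpperSet (((univ.filter fun q : Pd n => (Fin.snoc q 0 : Pd (n + 1)) ∈ Bu) : Finset (Pd n)) : Set (Pd n)) := isUpperSet_filter_snoc hB 0
  have hC0up : IsUpperSet (((univ.filter fun q : Pd n => (Fin.snoc q 0 : Pd (n + 1)) ∈ Cu) : Finset (Pd n)) : Set (Pd n)) := isUpperSet_filter_snoc hC 0
  have sA : (univ.filter fun q : Pd n => (Fin.snoc q 0 : Pd (n + 1)) ∈ Au) ⊆ (univ.filter fun q : Pd n => (Fin.snoc q 2 : Pd (n + 1)) ∈ Au) := by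
    intro q hq
    rw [mem_filter] at hq ⊢
    exact ⟨mem_univ _, hA (snoc_le_snoc_of_le q (by decide : (0:Fin 3) ≤ 2)) hq.2⟩
  have sB : (univ.filter fun q : Pd n => (Fin.snoc q 0 : Pd (n + 1)) ∈ Bu) ⊆ (univ.filter fun q : Pd n => (Fin.snoc q 2 : Pd (n + 1)) ∈ Bu) := by
    intro q hq
    rw [mem_filter] at hq ⊢
    exact ⟨mem_univ _, hB (snoc_le_snoc_of_le q (by decide : (0:Fin 3) ≤ 2)) hq.2⟩
  have sC : (univ.filter fun q : Pd n => (Fin.snoc q 0 : Pd (n + 1)) ∈ Cu) ⊆ (univ.filter fun q : Pd n => (Fin.snoc q 2 : Pd (n + 1)) ∈ Cu) := by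
    intro q hq
    rw [mem_filter] at hq ⊢
    exact ⟨mem_univ _, hC (snoc_le_snoc_of_le q (by decide : (0:Fin 3) ≤ 2)) hq.2⟩
  have nA : ∀ p, ind (univ.filter fun q : Pd n => (Fin.snoc q 0 : Pd (n + 1)) ∈ Au) p ≤ ind (univ.filter fun q : Pd n => (Fin.snoc q 2 : Pd (n + 1)) ∈ Au) p := fun p => by
    rw [ind_filter_snoc, ind_filter_snoc]; exact ind_snoc_mono hA p (by decide)
  have nB : ∀ p, ind (univ.filter fun q : Pd n => (Fin.snoc q 0 : Pd (n + 1)) ∈ Bu) p ≤ ind (univ.filter fun q : Pd n => (Fin.snoc q 2 : Pd (n + 1)) ∈ Bu) p := fun p => by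
    rw [ind_filter_snoc, ind_filter_snoc]; exact ind_snoc_mono hB p (by decide)
  have nC : ∀ p, ind (univ.filter fun q : Pd n => (Fin.snoc q 0 : Pd (n + 1)) ∈ Cu) p ≤ ind (univ.filter fun q : Pd n => (Fin.snoc q 2 : Pd (n + 1)) ∈ Cu) p := fun p => by
    rw [ind_filter_snoc, ind_filter_snoc]; exact ind_snoc_mono hC p (by decide)
  -- Θ_A ≥ 0 : fibre Kleitman (first-point form) with the increment A² \ A⁰
  have TA : 0 ≤ ((∑ p, ∑ q, ind (univ.filter fun q : Pd n => (Fin.snoc q 2 : Pd (n + 1)) ∈ Au) p * ind (univ.filter fun q : Pd n => (Fin.snoc q 2 : Pd (n + 1)) ∈ Bu) q * ind (univ.filter fun q : Pd n => (Fin.snoc q 2 : Pd (n + 1)) ∈ Cu) q * (if TotDist p q = true then (1:ℤ) else 0)) - (∑ p, ∑ q, ind (univ.filter fun q : Pd n => (Fin.snoc q 0 : Pd (n + 1)) ∈ Au) p * ind (univ.filter fun q : Pd n => (Fin.snoc q 2 : Pd (n + 1)) ∈ Bu) q * ind (univ.filter fun q : Pd n => (Fin.snoc q 2 : Pd (n +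 1)) ∈ Cu) q * (if TotDist p q = true then (1:ℤ) else 0)) - (∑ q, ∑ r, ind (univ.filter fun q : Pd n => (Fin.snoc q 2 : Pd (n + 1)) ∈ Bu) q * ind (univ.filter fun q : Pd n => (Fin.snoc q 2 : Pd (n + 1)) ∈ Cu) r * ind (univ.filter fun q : Pd n => (Fin.snoc q 2 : Pd (n + 1)) ∈ Au) (thirdPt q r) * (if TotDist q r = true then (1:ℤ) else 0)) + (∑ q, ∑ r, ind (univ.filter fun q : Pd n => (Fin.snoc q 2 : Pd (n + 1)) ∈ Bu) q * ind (univ.filter fun q : Pd n => (Fin.snoc q 2 : Pd (n + 1)) ∈ Cu) r * ind (univ.filter fun q : Pd n => (Fin.snoc q 0 : Pd (n + 1)) ∈ Au) (thirdPt q r) * (if TotDist q r = true then (1:ℤ) else 0))) := by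
    have K0 := sum_lat_le_td_first ((univ.filter fun q : Pd n => (Fin.snoc q 2 : Pd (n + 1)) ∈ Au) \ (univ.filter fun q : Pd n => (Fin.snoc q 0 : Pd (n + 1)) ∈ Au)) hB2up hC2up
    have e1 : (∑ q, ∑ r, ind (univ.filter fun q : Pd n => (Fin.snoc q 2 : Pd (n + 1)) ∈ Bu) q * ind (univ.filter fun q : Pd n => (Fin.snoc q 2 : Pd (n + 1)) ∈ Cu) r * ind ((univ.filter fun q : Pd n => (Fin.snoc q 2 : Pd (n + 1)) ∈ Au) \ (univ.filter fun q : Pd n => (Fin.snoc q 0 : Pd (n + 1)) ∈ Au)) (thirdPt q r) * (if TotDist q r = true then (1:ℤ) else 0)) =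
        (∑ q, ∑ r, ind (univ.filter fun q : Pd n => (Fin.snoc q 2 : Pd (n + 1)) ∈ Bu) q * ind (univ.filter fun q : Pd n => (Fin.snoc q 2 : Pd (n + 1)) ∈ Cu) r * ind (univ.filter fun q : Pd n => (Fin.snoc q 2 : Pd (n + 1)) ∈ Au) (thirdPt q r) * (if TotDist q r = true then (1:ℤ) else 0)) - (∑ q, ∑ r, ind (univ.filter fun q : Pd n => (Fin.snoc q 2 : Pd (n + 1)) ∈ Bu) q * ind (univ.filter fun q : Pd n => (Fin.snoc q 2 : Pd (n + 1)) ∈ Cu) r * ind (univ.filter fun q : Pd n => (Fin.snoc q 0 : Pd (n + 1)) ∈ Au) (thirdPt q r) * (if TotDist q r = true then (1:ℤ) else 0)) := by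
      rw [← Finset.sum_sub_distrib]
      refine Finset.sum_congr rfl fun q _ => ?_
      rw [← Finset.sum_sub_distrib]
      refine Finset.sum_congr rfl fun r _ => ?_
      rw [ind_sdiff_of_subset sA]; ring
    have e2 : (∑ p, ∑ q, ind ((univ.filter fun q : Pd n => (Fin.snoc q 2 : Pd (n + 1)) ∈ Au) \ (univ.filter fun q : Pd n => (Fin.snoc q 0 : Pd (n + 1)) ∈ Au)) p * ind (univ.filter fun q : Pd n => (Fin.snoc q 2 : Pd (n + 1)) ∈ Bu) q * ind (univ.filter fun q : Pd n => (Fin.snoc q 2 : Pd (n + 1)) ∈ Cu) q * (if TotDist p q = true then (1:ℤ) else 0)) =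
        (∑ p, ∑ q, ind (univ.filter fun q : Pd n => (Fin.snoc q 2 : Pd (n + 1)) ∈ Au) p * ind (univ.filter fun q : Pd n => (Fin.snoc q 2 : Pd (n + 1)) ∈ Bu) q * ind (univ.filter fun q : Pd n => (Fin.snoc q 2 : Pd (n + 1)) ∈ Cu) q * (if TotDist p q = true then (1:ℤ) else 0)) - (∑ p, ∑ q, ind (univ.filter fun q : Pd n => (Fin.snoc q 0 : Pd (n + 1)) ∈ Au) p * ind (univ.filter fun q : Pd n => (Fin.snoc q 2 : Pd (n + 1)) ∈ Bu) q * ind (univ.filter fun q : Pd n => (Fin.snoc q 2 : Pd (n + 1)) ∈ Cu) q * (if TotDist p q = true then (1:ℤ) else 0)) := by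
      rw [← Finset.sum_sub_distrib]
      refine Finset.sum_congr rfl fun p _ => ?_
      rw [← Finset.sum_sub_distrib]
      refine Finset.sum_congr rfl fun q _ => ?_
      rw [ind_sdiff_of_subset sA]; ring
    rw [e1, e2] at K0
    linarith
  -- Θ_B ≥ 0 : fibre Kleitman with the increment B² \ B⁰ at the first point
  have TB : 0 ≤ ((∑ p, ∑ q, ind (univ.filter fun q : Pd n => (Fin.snoc q 2 : Pd (n + 1)) ∈ Bu) p * ind (univ.filter fun q : Pd n => (Fin.snoc q 2 : Pd (n + 1)) ∈ Au) q * ind (univ.filter fun q : Pd n => (Fin.snoc q 2 : Pd (n + 1)) ∈ Cu) q * (if TotDist p q = true then (1:ℤ) else 0)) - (∑ p, ∑ q, ind (univ.filter fun q : Pd n => (Fin.snoc q 0 : Pd (n + 1)) ∈ Bu) p * ind (univ.filter fun q : Pd n => (Fin.snoc q 2 : Pd (n + 1)) ∈ Au) q * ind (univ.filter fun q : Pd n => (Fin.snoc q 2 : Pd (n + 1)) ∈ Cu) q * (if TotDist p q = true then (1:ℤ) else 0)) - (∑ q, ∑ r, ind (univ.filter fun q : Pd n => (Fin.snoc q 2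 : Pd (n + 1)) ∈ Bu) q * ind (univ.filter fun q : Pd n => (Fin.snoc q 2 : Pd (n + 1)) ∈ Cu) r * ind (univ.filter fun q : Pd n => (Fin.snoc q 2 : Pd (n + 1)) ∈ Au) (thirdPt q r) * (if TotDist q r = true then (1:ℤ) else 0)) + (∑ q, ∑ r, ind (univ.filter fun q : Pd n => (Fin.snoc q 0 : Pd (n + 1)) ∈ Bu) q * ind (univ.filter fun q : Pd n => (Fin.snoc q 2 : Pd (n + 1)) ∈ Cu) r * ind (univ.filter fun q : Pd n => (Fin.snoc q 2 : Pd (n + 1)) ∈ Au) (thirdPt q r) * (if TotDist q r = true then (1:ℤ) else 0))) := by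
    have K0 := sum_ind_lat_le_td ((univ.filter fun q : Pd n => (Fin.snoc q 2 : Pd (n + 1)) ∈ Bu) \ (univ.filter fun q : Pd n => (Fin.snoc q 0 : Pd (n + 1)) ∈ Bu)) hC2up hA2up
    have e1 : (∑ p, ∑ q, ind ((univ.filter fun q : Pd n => (Fin.snoc q 2 : Pd (n + 1)) ∈ Bu) \ (univ.filter fun q : Pd n => (Fin.snoc q 0 : Pd (n + 1)) ∈ Bu)) p * ind (univ.filter fun q : Pd n => (Fin.snoc q 2 : Pd (n + 1)) ∈ Cu) q * ind (univ.filter fun q : Pd n => (Fin.snoc q 2 : Pd (n + 1)) ∈ Au) (thirdPt p q) * (if TotDist p q = true then (1:ℤ) else 0)) =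
        (∑ q, ∑ r, ind (univ.filter fun q : Pd n => (Fin.snoc q 2 : Pd (n + 1)) ∈ Bu) q * ind (univ.filter fun q : Pd n => (Fin.snoc q 2 : Pd (n + 1)) ∈ Cu) r * ind (univ.filter fun q : Pd n => (Fin.snoc q 2 : Pd (n + 1)) ∈ Au) (thirdPt q r) * (if TotDist q r = true then (1:ℤ) else 0)) - (∑ q, ∑ r, ind (univ.filter fun q : Pd n => (Fin.snoc q 0 : Pd (n + 1)) ∈ Bu) q * ind (univ.filter fun q : Pd n => (Fin.snoc q 2 : Pd (n + 1)) ∈ Cu) r * ind (univ.filter fun q : Pd n => (Fin.snoc q 2 : Pd (n + 1)) ∈ Au) (thirdPt q r) * (if TotDist q r = true then (1:ℤ) else 0)) := by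
      rw [← Finset.sum_sub_distrib]
      refine Finset.sum_congr rfl fun p _ => ?_
      rw [← Finset.sum_sub_distrib]
      refine Finset.sum_congr rfl fun q _ => ?_
      rw [ind_sdiff_of_subset sB]; ring
    have e2 : (∑ p, ∑ q, ind ((univ.filter fun q : Pd n => (Fin.snoc q 2 : Pd (n + 1)) ∈ Bu) \ (univ.filter fun q : Pd n => (Fin.snoc q 0 : Pd (n + 1)) ∈ Bu)) p * ind (univ.filter fun q : Pd n => (Fin.snoc q 2 : Pd (n + 1)) ∈ Cu) q * ind (univ.filter fun q : Pd n => (Fin.snoc q 2 : Pd (n + 1)) ∈ Au) q * (if TotDist p q = true then (1:ℤ) else 0)) =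
        (∑ p, ∑ q, ind (univ.filter fun q : Pd n => (Fin.snoc q 2 : Pd (n + 1)) ∈ Bu) p * ind (univ.filter fun q : Pd n => (Fin.snoc q 2 : Pd (n + 1)) ∈ Au) q * ind (univ.filter fun q : Pd n => (Fin.snoc q 2 : Pd (n + 1)) ∈ Cu) q * (if TotDist p q = true then (1:ℤ) else 0)) - (∑ p, ∑ q, ind (univ.filter fun q : Pd n => (Fin.snoc q 0 : Pd (n + 1)) ∈ Bu) p * ind (univ.filter fun q : Pd n => (Fin.snoc q 2 : Pd (n + 1)) ∈ Au) q * ind (univ.filter fun q : Pd n => (Fin.snoc q 2 : Pd (n + 1)) ∈ Cu) q * (if TotDist p q = true then (1:ℤ) else 0)) := by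
      rw [← Finset.sum_sub_distrib]
      refine Finset.sum_congr rfl fun p _ => ?_
      rw [← Finset.sum_sub_distrib]
      refine Finset.sum_congr rfl fun q _ => ?_
      rw [ind_sdiff_of_subset sB]; ring
    rw [e1, e2] at K0
    linarith
  -- Θ_C ≥ 0 : fibre Kleitman with the increment C² \ C⁰ at the first point, re-indexed
  have TC : 0 ≤ ((∑ p, ∑ q, ind (univ.filter fun q : Pd n => (Fin.snoc q 2 : Pd (n + 1)) ∈ Cu) p * ind (univ.filter fun q : Pd n => (Fin.snoc q 2 : Pd (n + 1)) ∈ Au) q * ind (univ.filter fun q : Pd n => (Fin.snoc q 2 : Pd (n + 1)) ∈ Bu) q * (if TotDist p q = true then (1:ℤ) else 0)) - (∑ p, ∑ q, ind (univ.filter fun q : Pd n => (Fin.snoc q 0 : Pd (n + 1)) ∈ Cu) p * ind (univ.filter fun q : Pd n => (Fin.snoc q 2 : Pd (n + 1)) ∈ Au) q * ind (univ.filter fun q : Pd n => (Fin.snoc q 2 : Pd (n + 1)) ∈ Bu) q * (if TotDist p q = true then (1:ℤ) else 0)) - (∑ q, ∑ r, ind (univ.filter fun q : Pd n => (Fin.snoc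 q 2 : Pd (n + 1)) ∈ Bu) q * ind (univ.filter fun q : Pd n => (Fin.snoc q 2 : Pd (n + 1)) ∈ Cu) r * ind (univ.filter fun q : Pd n => (Fin.snoc q 2 : Pd (n + 1)) ∈ Au) (thirdPt q r) * (if TotDist q r = true then (1:ℤ) else 0)) + (∑ q, ∑ r, ind (univ.filter fun q : Pd n => (Fin.snoc q 2 : Pd (n + 1)) ∈ Bu) q * ind (univ.filter fun q : Pd n => (Fin.snoc q 0 : Pd (n + 1)) ∈ Cu) r * ind (univ.filter fun q : Pd n => (Fin.snoc q 2 : Pd (n + 1)) ∈ Au) (thirdPt q r) * (if TotDist q r = true then (1:ℤ) else 0))) := by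
    have K0 := sum_ind_lat_le_td ((univ.filter fun q : Pd n => (Fin.snoc q 2 : Pd (n + 1)) ∈ Cu) \ (univ.filter fun q : Pd n => (Fin.snoc q 0 : Pd (n + 1)) ∈ Cu)) hB2up hA2up
    have e1 : (∑ p, ∑ q, ind ((univ.filter fun q : Pd n => (Fin.snoc q 2 : Pd (n + 1)) ∈ Cu) \ (univ.filter fun q : Pd n => (Fin.snoc q 0 : Pd (n + 1)) ∈ Cu)) p * ind (univ.filter fun q : Pd n => (Fin.snoc q 2 : Pd (n + 1)) ∈ Bu) q * ind (univ.filter fun q : Pd n => (Fin.snoc q 2 : Pd (n + 1)) ∈ Au) (thirdPt p q) * (if TotDist p q = true then (1:ℤ) else 0)) =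
        (∑ q, ∑ r, ind (univ.filter fun q : Pd n => (Fin.snoc q 2 : Pd (n + 1)) ∈ Bu) q * ind (univ.filter fun q : Pd n => (Fin.snoc q 2 : Pd (n + 1)) ∈ Cu) r * ind (univ.filter fun q : Pd n => (Fin.snoc q 2 : Pd (n + 1)) ∈ Au) (thirdPt q r) * (if TotDist q r = true then (1:ℤ) else 0)) - (∑ q, ∑ r, ind (univ.filter fun q : Pd n => (Fin.snoc q 2 : Pd (n + 1)) ∈ Bu) q * ind (univ.filter fun q : Pd n => (Fin.snoc q 0 : Pd (n + 1)) ∈ Cu) r * ind (univ.filter fun q : Pd n => (Fin.snoc q 2 : Pd (n + 1)) ∈ Au) (thirdPt q r) * (if TotDist q r = true then (1:ℤ) else 0)) := by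
      rw [Finset.sum_comm, ← Finset.sum_sub_distrib]
      refine Finset.sum_congr rfl fun q _ => ?_
      rw [← Finset.sum_sub_distrib]
      refine Finset.sum_congr rfl fun r _ => ?_
      rw [ind_sdiff_of_subset sC, thirdPt_comm r q, totDist_symm r q]; ring
    have e2 : (∑ p, ∑ q, ind ((univ.filter fun q : Pd n => (Fin.snoc q 2 : Pd (n + 1)) ∈ Cu) \ (univ.filter fun q : Pd n => (Fin.snoc q 0 : Pd (n + 1)) ∈ Cu)) p * ind (univ.filter fun q : Pd n => (Fin.snoc q 2 : Pd (n + 1)) ∈ Bu) q * ind (univ.filter fun q : Pd n => (Fin.snoc q 2 : Pd (n + 1)) ∈ Au) q * (if TotDist p q = true then (1:ℤ) else 0)) =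
        (∑ p, ∑ q, ind (univ.filter fun q : Pd n => (Fin.snoc q 2 : Pd (n + 1)) ∈ Cu) p * ind (univ.filter fun q : Pd n => (Fin.snoc q 2 : Pd (n + 1)) ∈ Au) q * ind (univ.filter fun q : Pd n => (Fin.snoc q 2 : Pd (n + 1)) ∈ Bu) q * (if TotDist p q = true then (1:ℤ) else 0)) - (∑ p, ∑ q, ind (univ.filter fun q : Pd n => (Fin.snoc q 0 : Pd (n + 1)) ∈ Cu) p * ind (univ.filter fun q : Pd n => (Fin.snoc q 2 : Pd (n + 1)) ∈ Au) q * ind (univ.filter fun q : Pd n => (Fin.snoc q 2 : Pd (n + 1)) ∈ Bu) q * (if TotDist p q = true then (1:ℤ) else 0)) := by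
      rw [← Finset.sum_sub_distrib]
      refine Finset.sum_congr rfl fun p _ => ?_
      rw [← Finset.sum_sub_distrib]
      refine Finset.sum_congr rfl fun q _ => ?_
      rw [ind_sdiff_of_subset sC]; ring
    rw [e1, e2] at K0
    linarith
  -- H ≥ 0 : coefficientwise Harris
  have HA : (∑ p, ∑ q, ind (univ.filter fun q : Pd n => (Fin.snoc q 2 : Pd (n + 1)) ∈ Au) p * ind (univ.filter fun q : Pd n => (Fin.snoc q 0 : Pd (n + 1)) ∈ Bu) q * ind (univ.filter fun q : Pd n => (Fin.snoc q 0 : Pd (n + 1)) ∈ Cu) q * (if TotDist p q = true then (1:ℤ) else 0)) ≤ 2 ^ n * (∑ p, ind (univ.filter fun q : Pd n => (Fin.snoc q 2 : Pd (n + 1)) ∈ Au) p * ind (univ.filter fun q : Pd n => (Fin.snoc q 0 : Pd (n + 1)) ∈ Bu) p * ind (univ.filter fun q : Pd n => (Fin.snoc q 0 : Pd (n + 1)) ∈ Cu) p) := sum_ind3_totDist_le hA2up hB0up hC0up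
  have HB0 := sum_ind3_totDist_le hB2up hA0up hC0up
  have HB : (∑ p, ∑ q, ind (univ.filter fun q : Pd n => (Fin.snoc q 2 : Pd (n + 1)) ∈ Bu) p * ind (univ.filter fun q : Pd n => (Fin.snoc q 0 : Pd (n + 1)) ∈ Au) q * ind (univ.filter fun q : Pd n => (Fin.snoc q 0 : Pd (n + 1)) ∈ Cu) q * (if TotDist p q = true then (1:ℤ) else 0)) ≤ 2 ^ n * (∑ p, ind (univ.filter fun q : Pd n => (Fin.snoc q 0 : Pd (n + 1)) ∈ Au) p * ind (univ.filter fun q : Pd n => (Fin.snoc q 2 : Pd (n + 1)) ∈ Bu) p * ind (univ.filter fun q : Pd n => (Fin.snoc q 0 : Pd (n + 1)) ∈ Cu) p) := by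
    refine le_trans HB0 (le_of_eq ?_); congr 1
    exact Finset.sum_congr rfl fun p _ => by ring
  have HC0 := sum_ind3_totDist_le hC2up hA0up hB0up
  have HC : (∑ p, ∑ q, ind (univ.filter fun q : Pd n => (Fin.snoc q 2 : Pd (n + 1)) ∈ Cu) p * ind (univ.filter fun q : Pd n => (Fin.snoc q 0 : Pd (n + 1)) ∈ Au) q * ind (univ.filter fun q : Pd n => (Fin.snoc q 0 : Pd (n + 1)) ∈ Bu) q * (if TotDist p q = true then (1:ℤ) else 0)) ≤ 2 ^ n * (∑ p, ind (univ.filter fun q : Pd n => (Fin.snoc q 0 : Pd (n + 1)) ∈ Au) p * ind (univ.filter fun q : Pd n => (Fin.snoc q 0 : Pd (n + 1)) ∈ Bu) p * ind (univ.filter fun q : Pd n => (Fin.snoc q 2 : Pd (n + 1)) ∈ Cu) p) := by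
    refine le_trans HC0 (le_of_eq ?_); congr 1
    exact Finset.sum_congr rfl fun p _ => by ring
  -- R₂ ≥ 0 pointwise
  have R2 : 0 ≤ (∑ p, ind (univ.filter fun q : Pd n => (Fin.snoc q 2 : Pd (n + 1)) ∈ Au) p * ind (univ.filter fun q : Pd n => (Fin.snoc q 2 : Pd (n + 1)) ∈ Bu) p * ind (univ.filter fun q : Pd n => (Fin.snoc q 2 : Pd (n + 1)) ∈ Cu) p) - (∑ p, ind (univ.filter fun q : Pd n => (Fin.snoc q 0 : Pd (n + 1)) ∈ Au) p * ind (univ.filter fun q : Pd n => (Fin.snoc q 0 : Pd (n + 1)) ∈ Bu) p * ind (univ.filter fun q : Pd n => (Fin.snoc q 2 : Pd (n + 1)) ∈ Cu) p) - (∑ p, ind (univ.filter fun q : Pd n => (Fin.snoc q 0 : Pd (n + 1)) ∈ Au) p * ind (univ.filter fun q : Pd n => (Fin.snoc q 2 : Pd (n + 1)) ∈ Bu) p * ind (univ.filter fun q : Pd n => (Fin.snoc q 0 : Pd (n + 1)) ∈ Cu) p) - (∑ p, ind (univ.filter fun q : Pd n => (Fin.snoc q 2 : Pd (n + 1)) ∈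 Au) p * ind (univ.filter fun q : Pd n => (Fin.snoc q 0 : Pd (n + 1)) ∈ Bu) p * ind (univ.filter fun q : Pd n => (Fin.snoc q 0 : Pd (n + 1)) ∈ Cu) p) + 2 * (∑ p, ind (univ.filter fun q : Pd n => (Fin.snoc q 0 : Pd (n + 1)) ∈ Au) p * ind (univ.filter fun q : Pd n => (Fin.snoc q 0 : Pd (n + 1)) ∈ Bu) p * ind (univ.filter fun q : Pd n => (Fin.snoc q 0 : Pd (n + 1)) ∈ Cu) p) := by
    rw [Finset.mul_sum, ← Finset.sum_sub_distrib, ← Finset.sum_sub_distrib, ← Finset.sum_sub_distrib, ← Finset.sum_add_distrib]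
    refine Finset.sum_nonneg fun p _ => ?_
    have h := r2_pointwise_nonneg (ind (univ.filter fun q : Pd n => (Fin.snoc q 0 : Pd (n + 1)) ∈ Au) p) (ind (univ.filter fun q : Pd n => (Fin.snoc q 2 : Pd (n + 1)) ∈ Au) p) (ind (univ.filter fun q : Pd n => (Fin.snoc q 0 : Pd (n + 1)) ∈ Bu) p) (ind (univ.filter fun q : Pd n => (Fin.snoc q 2 : Pd (n + 1)) ∈ Bu) p) (ind (univ.filter fun q : Pd n => (Fin.snoc q 0 : Pd (n + 1)) ∈ Cu) p) (ind (univ.filter fun q : Pd n => (Fin.snoc q 2 : Pd (n + 1)) ∈ Cu) p)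
      (ind_eq_zero_or_one _ _) (ind_eq_zero_or_one _ _) (ind_eq_zero_or_one _ _) (ind_eq_zero_or_one _ _) (ind_eq_zero_or_one _ _) (ind_eq_zero_or_one _ _)
      (nA p) (nB p) (nC p)
    linarith
  have P2 : (0:ℤ) ≤ 2 ^ n := pow_nonneg (by norm_num) n
  have R2' : 0 ≤ (2 ^ n * ((∑ p, ind (univ.filter fun q : Pd n => (Fin.snoc q 2 : Pd (n + 1)) ∈ Au) p * ind (univ.filter fun q : Pd n => (Fin.snoc q 2 : Pd (n + 1)) ∈ Bu) p * ind (univ.filter fun q : Pd n => (Fin.snoc q 2 : Pd (n + 1)) ∈ Cu) p) - (∑ p, ind (univ.filter fun q : Pd n => (Fin.snoc q 0 : Pd (n + 1)) ∈ Au) p * ind (univ.filter fun q : Pd n => (Fin.snoc q 0 : Pd (n + 1)) ∈ Bu) p * ind (univ.filter fun q : Pd n => (Fin.snoc q 2 : Pd (n + 1)) ∈ Cu) p) - (∑ p, ind (univ.filter fun q : Pd n => (Fin.snoc q 0 : Pd (n + 1)) ∈ Au) p * ind (univ.filter fun q : Pd n => (Fin.snoc q 2 : Pd (n + 1)) ∈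 Bu) p * ind (univ.filter fun q : Pd n => (Fin.snoc q 0 : Pd (n + 1)) ∈ Cu) p) - (∑ p, ind (univ.filter fun q : Pd n => (Fin.snoc q 2 : Pd (n + 1)) ∈ Au) p * ind (univ.filter fun q : Pd n => (Fin.snoc q 0 : Pd (n + 1)) ∈ Bu) p * ind (univ.filter fun q : Pd n => (Fin.snoc q 0 : Pd (n + 1)) ∈ Cu) p) + 2 * (∑ p, ind (univ.filter fun q : Pd n => (Fin.snoc q 0 : Pd (n + 1)) ∈ Au) p * ind (univ.filter fun q : Pd n => (Fin.snoc q 0 : Pd (n + 1)) ∈ Bu) p * ind (univ.filter fun q : Pd n => (Fin.snoc q 0 : Pd (n + 1)) ∈ Cu) p))) := mul_nonneg P2 R2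
  linarith [eK, TA, TB, TC, HA, HB, HC, R2', hK]

/-! ### A face with `K(τ) = 0`: one top slice is the whole cube -/

/-- **COMB-M⁺ WHEN ONE TOP SLICE IS EVERYTHING** (every `n`): for an upper-step triple of up-sets `Au, Bu, Cu ⊆ [3]^{n+1}` with `C² = [3]^n` (the third set
contains every point of the two upper levels; its bottom slice `C⁰` is arbitrary), `2·sStarD A²B²C² ≤ sStarD Au Bu Cu`.  Here the comb third central moment of the top
vanishes (`K(A²,B²,univ) = [2^n D(A²B²) − N(univ;A²,B²)] + [N(B²;A²,·) − N(A²;B²,·)]` with the Latin term re-indexed into `N(B²;A²,·)`), so the κ-form applies. [this work] -/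
theorem two_mul_sStarD_top_le_of_upperStep_topUniv (Au Bu Cu : Finset (Pd (n + 1)))
    (hA : IsUpperSet (Au : Set (Pd (n + 1)))) (hB : IsUpperSet (Bu : Set (Pd (n + 1)))) (hC : IsUpperSet (Cu : Set (Pd (n + 1))))
    (hAu : ∀ q : Pd n, ind Au (Fin.snoc q 1 : Pd (n + 1)) = ind Au (Fin.snoc q 2 : Pd (n + 1)))
    (hBu : ∀ q : Pd n, ind Bu (Fin.snoc q 1 : Pd (n + 1)) = ind Bu (Fin.snoc q 2 : Pd (n + 1)))
    (hCu : ∀ q : Pd n, ind Cu (Fin.snoc q 1 : Pd (n + 1)) = ind Cu (Fin.snoc q 2 : Pd (n + 1)))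
    (hCtop : ∀ q : Pd n, (Fin.snoc q 2 : Pd (n + 1)) ∈ Cu) :
    2 * sStarD (univ.filter fun q : Pd n => (Fin.snoc q 2 : Pd (n + 1)) ∈ Au) (univ.filter fun q : Pd n => (Fin.snoc q 2 : Pd (n + 1)) ∈ Bu) (univ.filter fun q : Pd n => (Fin.snoc q 2 : Pd (n + 1)) ∈ Cu) ≤ sStarD Au Bu Cu := by
  refine two_mul_sStarD_top_le_of_upperStep_of_kappa_nonneg Au Bu Cu hA hB hC hAu hBu hCu ?_
  have hA2up : IsUpperSet (((univ.filter fun q : Pd n => (Fin.snoc q 2 : Pd (n + 1)) ∈ Au) : Finset (Pd n)) : Set (Pd n)) := isUpperSet_filter_snoc hA 2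
  have hB2up : IsUpperSet (((univ.filter fun q : Pd n => (Fin.snoc q 2 : Pd (n + 1)) ∈ Bu) : Finset (Pd n)) : Set (Pd n)) := isUpperSet_filter_snoc hB 2
  have hC2up : IsUpperSet (((univ.filter fun q : Pd n => (Fin.snoc q 2 : Pd (n + 1)) ∈ Cu) : Finset (Pd n)) : Set (Pd n)) := isUpperSet_filter_snoc hC 2
  have iC2 : ∀ p, ind (univ.filter fun q : Pd n => (Fin.snoc q 2 : Pd (n + 1)) ∈ Cu) p = 1 := fun p => by
    rw [ind_filter_snoc]; unfold ind; rw [if_pos (hCtop p)]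
  -- coefficientwise Harris at the `C²`-point
  have H0 := sum_ind3_totDist_le hC2up hA2up hB2up
  have H1 : (∑ p, ∑ q, ind (univ.filter fun q : Pd n => (Fin.snoc q 2 : Pd (n + 1)) ∈ Cu) p * ind (univ.filter fun q : Pd n => (Fin.snoc q 2 : Pd (n + 1)) ∈ Au) q * ind (univ.filter fun q : Pd n => (Fin.snoc q 2 : Pd (n + 1)) ∈ Bu) q * (if TotDist p q = true then (1:ℤ) else 0)) ≤ 2 ^ n * (∑ p, ind (univ.filter fun q : Pd n => (Fin.snoc q 2 : Pd (n + 1)) ∈ Au) p * ind (univ.filter fun q : Pd n => (Fin.snoc q 2 : Pd (n + 1)) ∈ Bu) p * ind (univ.filter fun q : Pd n => (Fin.snoc q 2 : Pd (n + 1)) ∈ Cu) p) := by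
    refine le_trans H0 (le_of_eq ?_); congr 1
    exact Finset.sum_congr rfl fun p _ => by ring
  -- the Latin term equals `N(B²;A²,·)` (re-index `r ↦ thirdPt q r`), and `N(A²;B²,·) = N(B²;A²,·)` (swap)
  have E1 : (∑ q, ∑ r, ind (univ.filter fun q : Pd n => (Fin.snoc q 2 : Pd (n + 1)) ∈ Bu) q * ind (univ.filter fun q : Pd n => (Fin.snoc q 2 : Pd (n + 1)) ∈ Cu) r * ind (univ.filter fun q : Pd n => (Fin.snoc q 2 : Pd (n + 1)) ∈ Au) (thirdPt q r) * (if TotDist q r = true then (1:ℤ) else 0)) = (∑ p, ∑ q, ind (univ.filter fun q : Pd n => (Fin.snoc q 2 : Pd (n + 1)) ∈ Bu) p * ind (univ.filter fun q : Pd n => (Fin.snoc q 2 : Pd (n + 1)) ∈ Au) q * ind (univ.filter fun q : Pd n => (Fin.snoc q 2 : Pd (n + 1)) ∈ Cu) q * (if TotDist p q = true then (1:ℤ) else 0)) := by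
    refine Finset.sum_congr rfl fun q _ => ?_
    rw [← sum_comp_thirdPt q (fun r => ind (univ.filter fun q : Pd n => (Fin.snoc q 2 : Pd (n + 1)) ∈ Bu) q * ind (univ.filter fun q : Pd n => (Fin.snoc q 2 : Pd (n + 1)) ∈ Au) r * ind (univ.filter fun q : Pd n => (Fin.snoc q 2 : Pd (n + 1)) ∈ Cu) r * (if TotDist q r = true then (1:ℤ) else 0))]
    refine Finset.sum_congr rfl fun r _ => ?_
    simp only [totDist_thirdPt_right, iC2]; ring
  have E2 : (∑ p, ∑ q, ind (univ.filter fun q : Pd n => (Fin.snoc q 2 : Pd (n + 1)) ∈ Au) p * ind (univ.filter fun q : Pd n => (Fin.snoc q 2 : Pd (n + 1)) ∈ Bu) q * ind (univ.filter fun q : Pd n => (Fin.snoc q 2 : Pd (n + 1)) ∈ Cu) q * (if TotDist p q = true then (1:ℤ) else 0)) = (∑ p, ∑ q, ind (univ.filter fun q : Pd n => (Fin.snoc q 2 : Pd (n + 1)) ∈ Bu) p * ind (univ.filter fun q : Pd n => (Fin.snoc q 2 : Pd (n + 1)) ∈ Au) q * ind (univ.filter fun q : Pd n => (Fin.snoc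 q 2 : Pd (n + 1)) ∈ Cu) q * (if TotDist p q = true then (1:ℤ) else 0)) := by
    rw [Finset.sum_comm]
    refine Finset.sum_congr rfl fun p _ => Finset.sum_congr rfl fun q _ => ?_
    rw [totDist_symm q p, iC2, iC2]; ring
  rw [E1, E2]
  linarith

/-! ### The single-mover face: two of the three sets are cylinders -/

/-- **COMB-M⁺ WHEN ONLY ONE SET MOVES** (every `n`): if `Au` and `Bu` are CYLINDERS along the last axis (bottom slice = top slice) and `Cu` is any upper-step
set, then `sStarD Au Bu Cu − 2·sStarD A²B²C² = 2·(sStarD A²B²C² + sStarD A⁰B⁰C⁰)` (the increment sums `X`, `N` of the symmetric form vanish), so top-slice dominance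
holds as soon as the top and bottom functionals are nonnegative (e.g. under `PatternPos n`; unconditional for `n ≤ 3`).  Together with the empty-bottom face and the
`K(τ) ≥ 0` face this leaves COMB-M⁺ open only for triples with all bottoms nonempty, at least two moving sets and a top of negative comb third central moment. [this work] -/
theorem two_mul_sStarD_top_le_of_upperStep_twoCylinders (Au Bu Cu : Finset (Pd (n + 1)))
    (hAu : ∀ q : Pd n, ind Au (Fin.snoc q 1 : Pd (n + 1)) = ind Au (Fin.snoc q 2 : Pd (n + 1)))
    (hBu : ∀ q : Pd n, ind Bu (Fin.snoc q 1 : Pd (n + 1)) = ind Bu (Fin.snoc q 2 : Pd (n + 1)))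
    (hCu : ∀ q : Pd n, ind Cu (Fin.snoc q 1 : Pd (n + 1)) = ind Cu (Fin.snoc q 2 : Pd (n + 1)))
    (hAcyl : ∀ q : Pd n, ind Au (Fin.snoc q 0 : Pd (n + 1)) = ind Au (Fin.snoc q 2 : Pd (n + 1)))
    (hBcyl : ∀ q : Pd n, ind Bu (Fin.snoc q 0 : Pd (n + 1)) = ind Bu (Fin.snoc q 2 : Pd (n + 1)))
    (htop : 0 ≤ sStarD (univ.filter fun q : Pd n => (Fin.snoc q 2 : Pd (n + 1)) ∈ Au) (univ.filter fun q : Pd n => (Fin.snoc q 2 : Pd (n + 1)) ∈ Bu) (univ.filter fun q : Pd n => (Fin.snoc q 2 : Pd (n + 1)) ∈ Cu))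
    (hbot : 0 ≤ sStarD (univ.filter fun q : Pd n => (Fin.snoc q 0 : Pd (n + 1)) ∈ Au) (univ.filter fun q : Pd n => (Fin.snoc q 0 : Pd (n + 1)) ∈ Bu) (univ.filter fun q : Pd n => (Fin.snoc q 0 : Pd (n + 1)) ∈ Cu)) :
    2 * sStarD (univ.filter fun q : Pd n => (Fin.snoc q 2 : Pd (n + 1)) ∈ Au) (univ.filter fun q : Pd n => (Fin.snoc q 2 : Pd (n + 1)) ∈ Bu) (univ.filter fun q : Pd n => (Fin.snoc q 2 : Pd (n + 1)) ∈ Cu) ≤ sStarD Au Bu Cu := by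
  have e := sStarD_upperStep_sub_two_mul_top Au Bu Cu hAu hBu hCu
  have iA : ∀ p, ind (univ.filter fun q : Pd n => (Fin.snoc q 0 : Pd (n + 1)) ∈ Au) p = ind (univ.filter fun q : Pd n => (Fin.snoc q 2 : Pd (n + 1)) ∈ Au) p := fun p => by rw [ind_filter_snoc, ind_filter_snoc, hAcyl p]
  have iB : ∀ p, ind (univ.filter fun q : Pd n => (Fin.snoc q 0 : Pd (n + 1)) ∈ Bu) p = ind (univ.filter fun q : Pd n => (Fin.snoc q 2 : Pd (n + 1)) ∈ Bu) p := fun p => by rw [ind_filter_snoc, ind_filter_snoc, hBcyl p]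
  simp only [iA, iB, sub_self, zero_mul, mul_zero, add_zero, Finset.sum_const_zero] at e
  nlinarith [e, htop, hbot]

/-! ### The comb third central moment is at most half the pattern functional -/

/-- **`2·K(τ) ≤ sStarD τ`** for every triple of up-sets of `[3]^n` (every `n`): with the counting form `sStarD = 2·2^n D − N_A − N_B − N_C + L` and
`K = 2^n D − N_A − N_B − N_C + 2L`, this is `3L ≤ N_A + N_B + N_C`, i.e. fibre Kleitman at each of the three points of a Latin triple.  Equivalently
`H⁺ ≥ 3K`, `κ := K/c ≤ 1/2`: the κ-form's top parameter is bounded on the positive side (memo §3). [this work] -/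
theorem two_mul_kappa_le_sStarD (A B C : Finset (Pd n))
    (hA : IsUpperSet (A : Set (Pd n))) (hB : IsUpperSet (B : Set (Pd n))) (hC : IsUpperSet (C : Set (Pd n))) :
    2 * (2 ^ n * (∑ p, ind A p * ind B p * ind C p) - (∑ p, ∑ q, ind A p * ind B q * ind C q * (if TotDist p q = true then (1:ℤ) else 0)) - (∑ p, ∑ q, ind B p * ind A q * ind C q * (if TotDist p q = true then (1:ℤ) else 0)) - (∑ p, ∑ q, ind C p * ind A q * ind B q * (if TotDist p q = true then (1:ℤ) else 0)) + 2 * (∑ q, ∑ r, ind B q * ind C r * ind A (thirdPt q r) * (if TotDist q r = true then (1:ℤ) else 0))) ≤ sStarD A B C := by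
  have eS := sStarD_counting A B C
  -- Kleitman at the `A`-point (first-point form)
  have K1 : (∑ q, ∑ r, ind B q * ind C r * ind A (thirdPt q r) * (if TotDist q r = true then (1:ℤ) else 0)) ≤ (∑ p, ∑ q, ind A p * ind B q * ind C q * (if TotDist p q = true then (1:ℤ) else 0)) := sum_lat_le_td_first A hB hC
  -- Kleitman at the `B`-point
  have K2' := sum_ind_lat_le_td B hC hA
  have K2 : (∑ q, ∑ r, ind B q * ind C r * ind A (thirdPt q r) * (if TotDist q r = true then (1:ℤ) else 0)) ≤ (∑ p, ∑ q, ind B p * ind A q * ind C q * (if TotDist p q = true then (1:ℤ) else 0)) := by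
    refine le_trans K2' (le_of_eq ?_)
    refine Finset.sum_congr rfl fun p _ => Finset.sum_congr rfl fun q _ => ?_
    ring
  -- Kleitman at the `C`-point (re-indexed)
  have K3' := sum_ind_lat_le_td C hB hA
  have K3 : (∑ q, ∑ r, ind B q * ind C r * ind A (thirdPt q r) * (if TotDist q r = true then (1:ℤ) else 0)) ≤ (∑ p, ∑ q, ind C p * ind A q * ind B q * (if TotDist p q = true then (1:ℤ) else 0)) := by
    have e : (∑ q, ∑ r, ind B q * ind C r * ind A (thirdPt q r) * (if TotDist q r = true then (1:ℤ) else 0)) = ∑ p, ∑ q, ind C p * ind B q * ind A (thirdPt p q) * (if TotDist p q = true then (1:ℤ) else 0) := by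
      rw [Finset.sum_comm]
      refine Finset.sum_congr rfl fun r _ => Finset.sum_congr rfl fun q _ => ?_
      rw [thirdPt_comm q r, totDist_symm q r]; ring
    rw [e]
    refine le_trans K3' (le_of_eq ?_)
    refine Finset.sum_congr rfl fun p _ => Finset.sum_congr rfl fun q _ => ?_
    ring
  rw [eS]
  linarith


end Summit.CriticalPhenomena.PercolationContinuityZ3.Theorems.SahiGridPattern
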